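import Summits.Ventures.Crystal3D.Theorems.StickyWulffConstantPolycrystalWulffBoundHyperplaneNull

/-!
# Power (Laguerre) cells: the monotonicity lemma and the COMPARISON PRINCIPLE for the weights
# (helper for line `PolyDensity` of crux `PolycrystalWulffBound`, stmt-Ventures-19482; lane P, poly-p2 g21)

Route `StickyWulffConstant` of the venture `Summits/Ventures/Crystal3D` (cell `crystal3d-full`).
Lane P certifies the paired sector–Knothe discrepancy `D_F(R) < c₀` on BOXES of rotations `R`
(memo `HOME/poly-p2/BOX1-g20.md`); the target cells of the second grain are the power (Laguerre) cells
`C_k(ψ) = {x | ⟪x, w_k⟫ − ψ_k ≥ ⟪x, w_j⟫ − ψ_j ∀ j}` of a fixed fan `w` with the weight vector `ψ = ψ(R)`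
solving the semi-discrete transport problem `|RW ∩ C_k(ψ)| = m_k`.  Over a box the certificates do NOT
enclose `ψ(R)` by a Newton–Kantorovich / Krawczyk argument but by the following ELEMENTARY COMPARISON
PRINCIPLE (BOX1-g20 §1, Lemma 1 and Theorem 2), which this file proves in the kernel in full generality
(arbitrary score functions `s k : X → ℝ` in place of `x ↦ ⟪w_k, x⟫`, arbitrary measure).

Throughout, the CELL FAMILY is a parameter `C : (ι → ℝ) → ι → Set X` characterised by the hypothesis
`hC : ∀ φ k x, x ∈ C φ k ↔ ∀ j, s j x - φ j ≤ s k x - φ k` (the cell of site `k` = the points at which `k`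
maximises `s j x − φ j`).  NO new definition is introduced: callers instantiate
`C := fun φ k => {x | ∀ j, s j x - φ j ≤ s k x - φ k}` and `hC := fun _ _ _ => Iff.rfl`.

* **Lemma 1** (`exists_mem_powerCell_of_isMax`, `biUnion_powerCell_argmax_subset`): if `k` maximises
  `φ − φ'`, every point of `C φ k` lies in `C φ' k'` for some maximiser `k'` of `φ − φ'`; i.e.
  `⋃_{k ∈ K} C_k(φ) ⊆ ⋃_{k ∈ K} C_k(φ')` for `K = argmax (φ − φ')`;
* **Theorem 2** (`powerCell_weights_le_of_measure_lt`, `powerCell_le_weights_of_lt_measure`): if the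
  `ψ`-cells have masses `μ (C ψ k) = m k`, the cells on the left of the comparison are null-measurable and
  `μ`-a.e. disjoint, `ψ i₀ = ψ⁺ i₀` (normalisation) and `μ (C ψ⁺ k) < m k` for every `k ≠ i₀`, then
  `ψ ≤ ψ⁺` componentwise; dually `m k < μ (C ψ⁻ k)` for `k ≠ i₀` and `ψ⁻ i₀ = ψ i₀` give `ψ⁻ ≤ ψ`.  No
  Jacobian, no continuity, no uniqueness of `ψ` is used — every normalised mass solution is enclosed;
* the LINEAR case (scores `⟪w k, ·⟫` on a finite-dimensional real inner product space, cells written out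
  as `{x | ∀ j, ⟪w j, x⟫ - φ j ≤ ⟪w k, x⟫ - φ k}`): two distinct cells of one weight vector meet inside an
  affine hyperplane (`linPowerCell_inter_subset_hyperplane`), hence are a.e. disjoint for every measure
  `μ ≪ volume` (`measure_linPowerCell_inter_eq_zero`, via `volume_setOf_inner_eq_zero` of
  `…HyperplaneNull`); the packaged two-sided statement is `linPowerCell_weights_between` — literally
  Theorem 2 of BOX1-g20 for `μ = volume.restrict (R • W)` and the 14-direction facet fan.

WHAT THIS IS NOT: a certificate (the 26 strict volume inequalities per box are verified off-kernel with
Taylor-model arithmetic); nothing about the crux itself; rung F-C1 not moved.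
-/

noncomputable section

namespace Summit.Ventures.Crystal3D.Theorems

open MeasureTheory Set
open scoped RealInnerProductSpace ENNReal

variable {ι X : Type*}

/-! ## Generalised power cells and the monotonicity lemma -/

/-- The cells of a finite nonempty index set cover the space: every point has a maximising site. -/
theorem exists_mem_powerCell [Finite ι] [Nonempty ι] (s : ι → X → ℝ) (C : (ι → ℝ) → ι → Set X)
    (hC : ∀ φ k x, x ∈ C φ k ↔ ∀ j, s j x - φ j ≤ s k x - φ k) (φ : ι → ℝ) (x : X) :
    ∃ k, x ∈ C φ k := by
  obtain ⟨k, hk⟩ := Finite.exists_max (fun j => s j x - φ j)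
  exact ⟨k, (hC φ k x).2 fun j => hk j⟩

/-- **Lemma 1 (monotonicity of power cells), pointwise form.**  If `k` maximises `φ − φ'` and
`x ∈ C φ k`, then `x ∈ C φ' k'` for some `k'` which ALSO maximises `φ − φ'`.
(Proof: take `k'` = a `φ'`-maximising site at `x`; adding the two defining inequalities gives
`φ k − φ' k ≤ φ k' − φ' k'`.) -/
theorem exists_mem_powerCell_of_isMax [Finite ι] [Nonempty ι] (s : ι → X → ℝ)
    (C : (ι → ℝ) → ι → Set X) (hC : ∀ φ k x, x ∈ C φ k ↔ ∀ j, s j x - φ j ≤ s k x - φ k)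
    (φ φ' : ι → ℝ) {k : ι} (hk : ∀ j, φ j - φ' j ≤ φ k - φ' k) {x : X} (hx : x ∈ C φ k) :
    ∃ k', (∀ j, φ j - φ' j ≤ φ k' - φ' k') ∧ x ∈ C φ' k' := by
  obtain ⟨k', hk'⟩ := exists_mem_powerCell s C hC φ' x
  refine ⟨k', fun j => ?_, hk'⟩
  have h1 : s k x - φ' k ≤ s k' x - φ' k' := (hC φ' k' x).1 hk' k
  have h2 : s k' x - φ k' ≤ s k x - φ k := (hC φ k x).1 hx k'
  have h3 : φ j - φ' j ≤ φ k - φ' k := hk j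
  linarith

/-- **Lemma 1 (monotonicity of power cells), union form.**  For any set `K` of sites CONTAINING every
maximiser of `φ − φ'` and CONSISTING of maximisers (e.g. `K = argmax (φ − φ')`),
`⋃_{k ∈ K} C φ k ⊆ ⋃_{k ∈ K} C φ' k`. -/
theorem biUnion_powerCell_argmax_subset [Finite ι] [Nonempty ι] (s : ι → X → ℝ)
    (C : (ι → ℝ) → ι → Set X) (hC : ∀ φ k x, x ∈ C φ k ↔ ∀ j, s j x - φ j ≤ s k x - φ k)
    (φ φ' : ι → ℝ) (K : Set ι) (hKmax : ∀ k ∈ K, ∀ j, φ j - φ' j ≤ φ k - φ' k)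
    (hmaxK : ∀ k, (∀ j, φ j - φ' j ≤ φ k - φ' k) → k ∈ K) :
    (⋃ k ∈ K, C φ k) ⊆ ⋃ k ∈ K, C φ' k := by
  intro x hx
  simp only [mem_iUnion, exists_prop] at hx ⊢
  obtain ⟨k, hkK, hxk⟩ := hx
  obtain ⟨k', hk'max, hxk'⟩ := exists_mem_powerCell_of_isMax s C hC φ φ' (hKmax k hkK) hxk
  exact ⟨k', hmaxK k' hk'max, hxk'⟩

/-! ## Theorem 2: the comparison principle for the weights -/

section Measure

variable [Fintype ι] [Nonempty ι] {mX : MeasurableSpace X}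

/-- **Theorem 2 (comparison principle), upper half.**  Let the `ψ`-cells have masses `m k`, be
null-measurable and pairwise `μ`-a.e. disjoint, and let `ψ⁺` agree with `ψ` at the normalising site
`i₀`.  If `μ (C ψ⁺ k) < m k` for every `k ≠ i₀`, then `ψ ≤ ψ⁺` componentwise.
(BOX1-g20 §1: otherwise `K = argmax (ψ − ψ⁺) ∌ i₀` is nonempty and Lemma 1 gives
`Σ_K m_k = μ (⋃_K C_k ψ) ≤ μ (⋃_K C_k ψ⁺) ≤ Σ_K μ (C_k ψ⁺) < Σ_K m_k`.) -/
theorem powerCell_weights_le_of_measure_lt (μ : Measure X) (s : ι → X → ℝ)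
    (C : (ι → ℝ) → ι → Set X) (hC : ∀ φ k x, x ∈ C φ k ↔ ∀ j, s j x - φ j ≤ s k x - φ k)
    (ψ ψu : ι → ℝ) (m : ι → ℝ≥0∞) (i₀ : ι) (h0 : ψ i₀ = ψu i₀)
    (hmass : ∀ k, μ (C ψ k) = m k)
    (hnull : ∀ k, NullMeasurableSet (C ψ k) μ)
    (hdisj : Pairwise fun j k => μ (C ψ j ∩ C ψ k) = 0)
    (hup : ∀ k, k ≠ i₀ → μ (C ψu k) < m k) :
    ∀ k, ψ k ≤ ψu k := by
  classical
  by_contra hcon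
  push Not at hcon
  obtain ⟨k₀, hk₀⟩ := hcon
  -- a maximiser of `ψ − ψu`
  obtain ⟨k₁, hk₁⟩ := Finite.exists_max (fun j => ψ j - ψu j)
  have hpos : 0 < ψ k₁ - ψu k₁ := lt_of_lt_of_le (by linarith) (hk₁ k₀)
  -- the argmax set
  set K : Finset ι := Finset.univ.filter (fun k => ∀ j, ψ j - ψu j ≤ ψ k - ψu k) with hKdef
  have hmemK : ∀ k, k ∈ K ↔ ∀ j, ψ j - ψu j ≤ ψ k - ψu k := by
    intro k; simp [hKdef]
  have hKne : K.Nonempty := ⟨k₁, (hmemK k₁).2 hk₁⟩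
  have hi₀ : ∀ k ∈ K, k ≠ i₀ := by
    intro k hk hki
    have h := (hmemK k).1 hk k₁
    rw [hki, h0, sub_self] at h
    linarith
  -- Lemma 1
  have hsub : (⋃ k ∈ (K : Set ι), C ψ k) ⊆ ⋃ k ∈ (K : Set ι), C ψu k :=
    biUnion_powerCell_argmax_subset s C hC ψ ψu (K : Set ι)
      (fun k hk => (hmemK k).1 (Finset.mem_coe.1 hk))
      (fun k hk => Finset.mem_coe.2 ((hmemK k).2 hk))
  -- the measure chain
  have h1 : μ (⋃ k ∈ K, C ψ k) = ∑ k ∈ K, μ (C ψ k) :=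
    measure_biUnion_finset₀ (fun j _ k _ hjk => hdisj hjk) (fun k _ => hnull k)
  have h2 : μ (⋃ k ∈ K, C ψ k) ≤ μ (⋃ k ∈ K, C ψu k) := measure_mono hsub
  have h3 : μ (⋃ k ∈ K, C ψu k) ≤ ∑ k ∈ K, μ (C ψu k) := measure_biUnion_finset_le K _
  have h4 : ∑ k ∈ K, μ (C ψu k) < ∑ k ∈ K, m k :=
    ENNReal.sum_lt_sum_of_nonempty hKne (fun k hk => hup k (hi₀ k hk))
  have h5 : ∑ k ∈ K, m k = ∑ k ∈ K, μ (C ψ k) :=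
    Finset.sum_congr rfl (fun k _ => (hmass k).symm)
  have : ∑ k ∈ K, μ (C ψ k) < ∑ k ∈ K, μ (C ψ k) :=
    calc ∑ k ∈ K, μ (C ψ k) = μ (⋃ k ∈ K, C ψ k) := h1.symm
      _ ≤ μ (⋃ k ∈ K, C ψu k) := h2
      _ ≤ ∑ k ∈ K, μ (C ψu k) := h3
      _ < ∑ k ∈ K, m k := h4
      _ = ∑ k ∈ K, μ (C ψ k) := h5
  exact lt_irrefl _ this

/-- **Theorem 2 (comparison principle), lower half.**  Let the `ψ`-cells have masses `m k`, let the
`ψ⁻`-cells be null-measurable and pairwise `μ`-a.e. disjoint, and `ψ⁻ i₀ = ψ i₀`.  If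
`m k < μ (C ψ⁻ k)` for every `k ≠ i₀`, then `ψ⁻ ≤ ψ` componentwise.
(Otherwise `K = argmax (ψ⁻ − ψ) ∌ i₀` is nonempty and
`Σ_K m_k < Σ_K μ (C_k ψ⁻) = μ (⋃_K C_k ψ⁻) ≤ μ (⋃_K C_k ψ) ≤ Σ_K m_k`.) -/
theorem powerCell_le_weights_of_lt_measure (μ : Measure X) (s : ι → X → ℝ)
    (C : (ι → ℝ) → ι → Set X) (hC : ∀ φ k x, x ∈ C φ k ↔ ∀ j, s j x - φ j ≤ s k x - φ k)
    (ψl ψ : ι → ℝ) (m : ι → ℝ≥0∞) (i₀ : ι) (h0 : ψl i₀ = ψ i₀)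
    (hmass : ∀ k, μ (C ψ k) = m k)
    (hnull : ∀ k, NullMeasurableSet (C ψl k) μ)
    (hdisj : Pairwise fun j k => μ (C ψl j ∩ C ψl k) = 0)
    (hlo : ∀ k, k ≠ i₀ → m k < μ (C ψl k)) :
    ∀ k, ψl k ≤ ψ k := by
  classical
  by_contra hcon
  push Not at hcon
  obtain ⟨k₀, hk₀⟩ := hcon
  obtain ⟨k₁, hk₁⟩ := Finite.exists_max (fun j => ψl j - ψ j)
  have hpos : 0 < ψl k₁ - ψ k₁ := lt_of_lt_of_le (by linarith) (hk₁ k₀)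
  set K : Finset ι := Finset.univ.filter (fun k => ∀ j, ψl j - ψ j ≤ ψl k - ψ k) with hKdef
  have hmemK : ∀ k, k ∈ K ↔ ∀ j, ψl j - ψ j ≤ ψl k - ψ k := by
    intro k; simp [hKdef]
  have hKne : K.Nonempty := ⟨k₁, (hmemK k₁).2 hk₁⟩
  have hi₀ : ∀ k ∈ K, k ≠ i₀ := by
    intro k hk hki
    have h := (hmemK k).1 hk k₁
    rw [hki, h0, sub_self] at h
    linarith
  have hsub : (⋃ k ∈ (K : Set ι), C ψl k) ⊆ ⋃ k ∈ (K : Set ι), C ψ k :=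
    biUnion_powerCell_argmax_subset s C hC ψl ψ (K : Set ι)
      (fun k hk => (hmemK k).1 (Finset.mem_coe.1 hk))
      (fun k hk => Finset.mem_coe.2 ((hmemK k).2 hk))
  have h1 : μ (⋃ k ∈ K, C ψl k) = ∑ k ∈ K, μ (C ψl k) :=
    measure_biUnion_finset₀ (fun j _ k _ hjk => hdisj hjk) (fun k _ => hnull k)
  have h2 : μ (⋃ k ∈ K, C ψl k) ≤ μ (⋃ k ∈ K, C ψ k) := measure_mono hsub
  have h3 : μ (⋃ k ∈ K, C ψ k) ≤ ∑ k ∈ K, μ (C ψ k) := measure_biUnion_finset_le K _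
  have h4 : ∑ k ∈ K, m k < ∑ k ∈ K, μ (C ψl k) :=
    ENNReal.sum_lt_sum_of_nonempty hKne (fun k hk => hlo k (hi₀ k hk))
  have h5 : ∑ k ∈ K, μ (C ψ k) = ∑ k ∈ K, m k := Finset.sum_congr rfl (fun k _ => hmass k)
  have : ∑ k ∈ K, m k < ∑ k ∈ K, m k :=
    calc ∑ k ∈ K, m k < ∑ k ∈ K, μ (C ψl k) := h4
      _ = μ (⋃ k ∈ K, C ψl k) := h1.symm
      _ ≤ μ (⋃ k ∈ K, C ψ k) := h2
      _ ≤ ∑ k ∈ K, μ (C ψ k) := h3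
      _ = ∑ k ∈ K, m k := h5
  exact lt_irrefl _ this

end Measure

/-! ## Linear power cells in a real inner product space: a.e. disjointness and the packaged theorem

The LINEAR power cells of a fan `w : ι → E` with weights `φ` are written out as the sets
`{x | ∀ j, ⟪w j, x⟫ - φ j ≤ ⟪w k, x⟫ - φ k}` (BOX1-g20 §1 `C_k(φ)`). -/

section Linear

variable {E : Type*} [NormedAddCommGroup E] [InnerProductSpace ℝ E]

/-- A linear power cell is closed (an intersection of closed half-spaces). -/
theorem isClosed_linPowerCell (w : ι → E) (φ : ι → ℝ) (k : ι) :
    IsClosed {x : E | ∀ j, ⟪w j, x⟫ - φ j ≤ ⟪w k, x⟫ - φ k} := by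
  have : {x : E | ∀ j, ⟪w j, x⟫ - φ j ≤ ⟪w k, x⟫ - φ k} =
      ⋂ j, {x : E | ⟪w j, x⟫ - φ j ≤ ⟪w k, x⟫ - φ k} := by
    ext x; simp [mem_iInter]
  rw [this]
  exact isClosed_iInter fun j =>
    isClosed_le ((continuous_const.inner continuous_id).sub continuous_const)
      ((continuous_const.inner continuous_id).sub continuous_const)

/-- Two DISTINCT cells of one weight vector meet inside the affine hyperplane
`{x | ⟪w k − w j, x⟫ = φ k − φ j}`. -/
theorem linPowerCell_inter_subset_hyperplane (w : ι → E) (φ : ι → ℝ) (j k : ι) :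
    {x : E | ∀ i, ⟪w i, x⟫ - φ i ≤ ⟪w j, x⟫ - φ j} ∩ {x : E | ∀ i, ⟪w i, x⟫ - φ i ≤ ⟪w k, x⟫ - φ k} ⊆
      {x : E | ⟪w k - w j, x⟫ = φ k - φ j} := by
  intro x hx
  have h1 : ⟪w k, x⟫ - φ k ≤ ⟪w j, x⟫ - φ j := hx.1 k
  have h2 : ⟪w j, x⟫ - φ j ≤ ⟪w k, x⟫ - φ k := hx.2 j
  simp only [mem_setOf_eq, inner_sub_left]
  linarith

variable [MeasurableSpace E] [BorelSpace E]

/-- A linear power cell is Borel measurable. -/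
theorem measurableSet_linPowerCell (w : ι → E) (φ : ι → ℝ) (k : ι) :
    MeasurableSet {x : E | ∀ j, ⟪w j, x⟫ - φ j ≤ ⟪w k, x⟫ - φ k} :=
  (isClosed_linPowerCell w φ k).measurableSet

variable [FiniteDimensional ℝ E]

/-- For an injective fan, two distinct cells of one weight vector are `volume`-a.e. disjoint. -/
theorem volume_linPowerCell_inter_eq_zero (w : ι → E) (hw : Function.Injective w) (φ : ι → ℝ)
    {j k : ι} (hjk : j ≠ k) :
    volume ({x : E | ∀ i, ⟪w i, x⟫ - φ i ≤ ⟪w j, x⟫ - φ j} ∩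
      {x : E | ∀ i, ⟪w i, x⟫ - φ i ≤ ⟪w k, x⟫ - φ k}) = 0 := by
  have hne : w k - w j ≠ 0 := sub_ne_zero.2 (fun h => hjk (hw h).symm)
  exact measure_mono_null (linPowerCell_inter_subset_hyperplane w φ j k)
    (volume_setOf_inner_eq_zero hne _)

/-- The same for every measure absolutely continuous with respect to `volume`
(e.g. `volume.restrict S`, the case of the box certificates with `S = R • W`). -/
theorem measure_linPowerCell_inter_eq_zero (μ : Measure E) (hμ : μ ≪ volume) (w : ι → E)
    (hw : Function.Injective w) (φ : ι → ℝ) {j k : ι} (hjk : j ≠ k) :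
    μ ({x : E | ∀ i, ⟪w i, x⟫ - φ i ≤ ⟪w j, x⟫ - φ j} ∩
      {x : E | ∀ i, ⟪w i, x⟫ - φ i ≤ ⟪w k, x⟫ - φ k}) = 0 :=
  hμ (volume_linPowerCell_inter_eq_zero w hw φ hjk)

/-- **Theorem 2 of BOX1-g20 (comparison tube for the Laguerre weights), packaged.**  Fan `w` injective,
`μ ≪ volume` (e.g. Lebesgue measure restricted to the rotated Wulff body), cell family `C` = the linear
power cells (hypothesis `hC`), `ψ` ANY weight vector whose cells have the prescribed masses `m k`,
normalised at `i₀` together with the candidate bounds `ψ⁻, ψ⁺`.  If for every `k ≠ i₀` the `ψ⁺`-cell has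
mass `< m k` and the `ψ⁻`-cell has mass `> m k`, then `ψ⁻ k ≤ ψ k ≤ ψ⁺ k` for every `k`.  (Applied `r` by
`r` on a box of rotations, with the 26 strict inequalities certified by Taylor-model volume enclosures; no
Jacobian / Krawczyk / continuity.) -/
theorem linPowerCell_weights_between [Fintype ι] [Nonempty ι] (μ : Measure E) (hμ : μ ≪ volume)
    (w : ι → E) (hw : Function.Injective w) (C : (ι → ℝ) → ι → Set E)
    (hC : ∀ φ k x, x ∈ C φ k ↔ ∀ j, ⟪w j, x⟫ - φ j ≤ ⟪w k, x⟫ - φ k)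
    (ψl ψ ψu : ι → ℝ) (m : ι → ℝ≥0∞) (i₀ : ι) (h0l : ψl i₀ = ψ i₀) (h0u : ψ i₀ = ψu i₀)
    (hmass : ∀ k, μ (C ψ k) = m k)
    (hup : ∀ k, k ≠ i₀ → μ (C ψu k) < m k)
    (hlo : ∀ k, k ≠ i₀ → m k < μ (C ψl k)) :
    ∀ k, ψl k ≤ ψ k ∧ ψ k ≤ ψu k := by
  -- the cell family IS the family of explicit sets
  have hCeq : ∀ φ k, C φ k = {x : E | ∀ j, ⟪w j, x⟫ - φ j ≤ ⟪w k, x⟫ - φ k} := by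
    intro φ k; ext x; exact hC φ k x
  have hnull : ∀ φ k, NullMeasurableSet (C φ k) μ := by
    intro φ k; rw [hCeq]; exact (measurableSet_linPowerCell w φ k).nullMeasurableSet
  have hdisj : ∀ φ : ι → ℝ, Pairwise fun j k => μ (C φ j ∩ C φ k) = 0 := by
    intro φ j k hjk
    show μ (C φ j ∩ C φ k) = 0
    rw [hCeq, hCeq]; exact measure_linPowerCell_inter_eq_zero μ hμ w hw φ hjk
  intro k
  refine ⟨?_, ?_⟩
  · exact powerCell_le_weights_of_lt_measure μ (fun k x => ⟪w k, x⟫) C hC ψl ψ m i₀ h0l hmass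
      (hnull ψl) (hdisj ψl) hlo k
  · exact powerCell_weights_le_of_measure_lt μ (fun k x => ⟪w k, x⟫) C hC ψ ψu m i₀ h0u hmass
      (hnull ψ) (hdisj ψ) hup k

end Linear

end Summit.Ventures.Crystal3D.Theorems

end
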